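import Mathlib
import Summits.ResolutionOfSingularities.ResolutionOfSingularities.Theorems.WeightedInvariantLocalWeightedDropTOT2StepBlowTwo
/-!
# TOT2-LINE (P3) B6 step (DIM-PREMISE VARIANT of res-L1-w43-stub-2's file: `hB4` carries `ringKrullDim (R₃ ⧸ P′) = 1`, as the landed bricks B4-1..4 do — res-L1-w43-lead-1 g6) 4/6: THE `u₂`-ORIGIN POINT ANSWER — the budget drops by at least one per surviving branch, and at a conflict

Sub-problem `ResolutionOfSingularities`, ENGINE crux `stmt-ResolutionOfSingularities-8899` (`LocalWeightedDrop`), skeleton v35 (2e806da509994632),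
registered stub `stub_conflictBudget` (P3); plan `L/res-L1-w43-stub-2/g6/B6-PLAN.md` §1.  [OURS · L1 W4.3 · chain w43 · res-L1-w43-stub-2 g6 (owner of
(P3)); def-free; bricks B3 / B4-2 / D3 v2 / injectivity for the chart `(u₁u₂, u₂, u₂y)` as typed HYPOTHESES; nothing here is a statement of any
manuscript; AI-produced, gate-checked, weaker than expert review.]

Successor `A′ = blowTwoT d A`, `N′ = insert 1 (N.filter (· = 0))` (so `β′ = 1`), chart `Φ f = f(u₁u₂, u₂, u₂y)`: a surviving branch has `b′ = b`,
`a′ + b′ = a` (B3 + `Φ u₁ = u₁u₂`), and `row_chartTwo` gives slack `1`; the conflict branch (`a = 1`) never survives, so it dies with charge `≥ 2`.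
* `conflictBudgetD_blowTwoT_le_of_dim`, `conflictBudgetD_blowTwoT_lt_of_dim`.
-/

set_option linter.dupNamespace false -- mandated namespace of this single-conjunct summit

noncomputable section

namespace Summit.ResolutionOfSingularities.ResolutionOfSingularities.Theorems

namespace TOT2Branch

open MvPowerSeries IsLocalRing PolyDescent Literature.AlgebraicGeometry.Resolution

variable {k : Type} [Field k]

section Step

variable {d : ℕ} {A : Fin d → MvPowerSeries (Fin 2) k} {N N' : Finset (Fin 2)}
  (Φ : MvPowerSeries (Fin 3) k →ₐ[k] MvPowerSeries (Fin 3) k)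

/-- **B6 STEP `u₂`-ORIGIN.**  `M′ ≤ M`, and `M′ < M` as soon as some non-line one-dimensional top-locus prime of `A` with `v(u₁) = 1` exists
(such a prime never survives at the `u₂`-origin: `a = a′ + b′ ≥ 2` there). -/
theorem conflictBudgetD_blowTwoT_le_of_dim (p : ℕ) [Fact p.Prime] [CharP k p] [IsAlgClosed k]
    (hΦ : ∀ f, Φ f = subst (![X 0 * X 1, X 1, X 1 * X 2] : Fin 3 → MvPowerSeries (Fin 3) k) f)
    (hB3 : ∀ (P' : Ideal (MvPowerSeries (Fin 3) k)) [P'.IsPrime], ringKrullDim (MvPowerSeries (Fin 3) k ⧸ P') = 1 →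
      (X 1 : MvPowerSeries (Fin 3) k) ∉ P' →
      ringKrullDim (MvPowerSeries (Fin 3) k ⧸ P'.comap Φ) = 1 ∧ ∀ f, branchVal (P'.comap Φ) f = branchVal P' (Φ f))
    (hB4 : ∀ (P' : Ideal (MvPowerSeries (Fin 3) k)), P' ∈ topPrimes d (blowTwoT d A) → (X 1 : MvPowerSeries (Fin 3) k) ∉ P' →
      ringKrullDim (MvPowerSeries (Fin 3) k ⧸ P') = 1 → P'.comap Φ ∈ topPrimes d A)
    (hD3 : ∀ (P Q : Ideal (MvPowerSeries (Fin 3) k)), P ∈ topPrimes d A → Q ∈ topPrimes d A → P ≠ Q →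
      ringKrullDim (MvPowerSeries (Fin 3) k ⧸ P) = 1 → ringKrullDim (MvPowerSeries (Fin 3) k ⧸ Q) = 1 → pairVal P Q < ⊤)
    (hinj : ∀ (P' Q' : Ideal (MvPowerSeries (Fin 3) k)), P'.IsPrime → Q'.IsPrime → ringKrullDim (MvPowerSeries (Fin 3) k ⧸ P') = 1 →
      ringKrullDim (MvPowerSeries (Fin 3) k ⧸ Q') = 1 → (X 1 : MvPowerSeries (Fin 3) k) ∉ P' → (X 1 : MvPowerSeries (Fin 3) k) ∉ Q' →
      P'.comap Φ = Q'.comap Φ → P' = Q')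
    (hctx : ∃ (b : MvPowerSeries (Fin (2 + 1)) k) (δ : TameFourTupleDrop.Decoration k 2) (Θ : Fin (2 + 1) → MvPowerSeries (Fin (2 + 1)) k),
      TameFourTupleDrop.Admissible b δ ∧ 2 ≤ δ.o ∧ δ.c = d ∧ δ.PresBy d A N Θ)
    (hN' : N' = insert 1 (N.filter fun l => l = 0)) :
    conflictBudgetD d (blowTwoT d A) N' ≤ conflictBudgetD d A N ∧
      ∀ P₀ ∈ topPrimesDNL d A, branchVal P₀ (X 0) = 1 → conflictBudgetD d (blowTwoT d A) N' < conflictBudgetD d A N := by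
  classical
  have hd2 : 2 ≤ d := NCBranchPrimes.two_le_of_presContext hctx
  have hsq : Squarefree (NCPoly.monicGerm d A) := NCBranchPrimes.squarefree_monicGerm_of_presContext hctx
  set A' := blowTwoT d A with hA'
  have hs : HasSubst (![X 0 * X 1, X 1, X 1 * X 2] : Fin 3 → MvPowerSeries (Fin 3) k) :=
    hasSubst_of_constantCoeff_zero fun i => by fin_cases i <;> simp
  have hΦX0 : Φ (X 0) = X 0 * X 1 := by rw [hΦ, subst_X hs]; rfl
  have hΦX1 : Φ (X 1) = X 1 := by rw [hΦ, subst_X hs]; rfl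
  have hΦ₂ : ∀ g : MvPowerSeries (Fin 2) k, Φ (toThree g) = toThree (subst (![X 0 * X 1, X 1] : Fin 2 → MvPowerSeries (Fin 2) k) g) := by
    intro g
    rw [hΦ, toThree]
    exact subst_rename_eq_rename_subst _ (fun i => by fin_cases i <;> simp) _ (fun i => by fin_cases i <;> simp)
      (fun i => by fin_cases i <;> simp [rename_X, map_mul, succAbove_two_one]) g
  have hβ' : betaTwo d A' N' = 1 := (betaTwo_eq_one_iff).mpr (Or.inl (by rw [hN']; simp))
  -- index sets
  have hfinS : (topPrimesDNL d A).Finite := (topPrimesNL_finite p hctx).subset (topPrimesDNL_subset_topPrimesNL d A)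
  set ι : Ideal (MvPowerSeries (Fin 3) k) → Ideal (MvPowerSeries (Fin 3) k) := fun P' => P'.comap Φ with hιdef
  have hιmem : ∀ P' ∈ topPrimesDNL d A', ι P' ∈ topPrimesDNL d A := by
    intro P' hP'
    obtain ⟨⟨hP'top, hdim'⟩, hX0', hX1'⟩ := hP'
    haveI := hP'top.1
    obtain ⟨hdim, -⟩ := hB3 P' hdim' hX1'
    refine ⟨⟨hB4 P' hP'top hX1' hdim', hdim⟩, ?_, ?_⟩
    · rw [hιdef, Ideal.mem_comap]; show Φ (X 0) ∉ P'; rw [hΦX0]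
      exact fun h => (hP'top.1.mem_or_mem h).elim hX0' hX1'
    · rw [hιdef, Ideal.mem_comap]; show Φ (X 1) ∉ P'; rw [hΦX1]; exact hX1'
  have hinjOn : Set.InjOn ι (topPrimesDNL d A') := by
    intro P' hP' Q' hQ' h
    exact hinj P' Q' hP'.1.1.1 hQ'.1.1.1 hP'.1.2 hQ'.1.2 hP'.2.2 hQ'.2.2 h
  have hfinS' : (topPrimesDNL d A').Finite :=
    Set.Finite.of_finite_image (hfinS.subset (fun P hP => by obtain ⟨P', hP', rfl⟩ := hP; exact hιmem P' hP')) hinjOn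
  set S := hfinS.toFinset with hSdef
  set S' := hfinS'.toFinset with hS'def
  have hmemS : ∀ {P}, P ∈ S ↔ P ∈ topPrimesDNL d A := fun {P} => Set.Finite.mem_toFinset _
  have hmemS' : ∀ {P'}, P' ∈ S' ↔ P' ∈ topPrimesDNL d A' := fun {P'} => Set.Finite.mem_toFinset _
  have hvals : ∀ P' ∈ topPrimesDNL d A',
      branchVal P' (X 0) ≠ ⊤ ∧ branchVal P' (X 1) ≠ ⊤ ∧ 1 ≤ branchVal P' (X 0) ∧ 1 ≤ branchVal P' (X 1) ∧
      branchVal P' (X 1) = branchVal (ι P') (X 1) ∧ branchVal P' (X 0) + branchVal P' (X 1) = branchVal (ι P') (X 0) := by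
    intro P' hP'
    obtain ⟨⟨hP'top, hdim'⟩, hX0', hX1'⟩ := hP'
    haveI := hP'top.1
    obtain ⟨-, hval⟩ := hB3 P' hdim' hX1'
    refine ⟨(branchVal_eq_top_iff_of_dim hdim' _).not.mpr hX0', (branchVal_eq_top_iff_of_dim hdim' _).not.mpr hX1',
      one_le_branchVal_X_of_dim hdim' 0, one_le_branchVal_X_of_dim hdim' 1, ?_, ?_⟩
    · rw [hιdef]; show _ = branchVal (P'.comap Φ) (X 1); rw [hval, hΦX1]
    · rw [hιdef]; show _ = branchVal (P'.comap Φ) (X 0); rw [hval, hΦX0, branchVal_mul_of_dim hdim']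
  have hc : ∀ P' ∈ S', charge d A' N' P' + 1 ≤ charge d A N (ι P') +
      2 * ∑ Q ∈ S.filter (fun Q => Q ∉ S'.image ι), ((pairVal (ι P') Q).toNat + (pairVal Q (ι P')).toNat) := by
    intro P' hP'
    obtain ⟨ha', hb', h1a, h1b, hbb, haa⟩ := hvals P' (hmemS'.mp hP')
    exact le_add_right (charge_chartTwo_le hβ' ha' hb' h1a h1b hbb haa)
  have hq : ∀ P' ∈ S', ∀ Q' ∈ S', P' ≠ Q' → (pairVal P' Q').toNat ≤ (pairVal (ι P') (ι Q')).toNat := by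
    intro P' hP' Q' hQ' hne
    have hP'm := hmemS'.mp hP'
    have hQ'm := hmemS'.mp hQ'
    haveI := hP'm.1.1.1
    haveI := hQ'm.1.1.1
    obtain ⟨-, hval⟩ := hB3 P' hP'm.1.2 hP'm.2.2
    have hle : pairVal P' Q' + branchVal P' (X 1) ≤ pairVal (ι P') (ι Q') :=
      pairVal_add_le_of_transport Φ.toRingHom (subst (![X 0 * X 1, X 1] : Fin 2 → MvPowerSeries (Fin 2) k)) hΦ₂ hP'm.1.2 rfl rfl
        (fun f => (hval f).symm ▸ rfl) (X 1) hQ'm.2.2 fun g hg0 => by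
          obtain ⟨ĝ, hĝ⟩ := exists_chartTwo_eq_mul hg0
          exact ⟨ĝ, by rw [hĝ, map_mul, toThree_X]; rfl⟩
    have hιne : ι P' ≠ ι Q' := fun h => hne (hinjOn hP'm hQ'm h)
    have hfin : pairVal (ι P') (ι Q') < ⊤ :=
      hD3 _ _ (hιmem P' hP'm).1.1 (hιmem Q' hQ'm).1.1 hιne (hιmem P' hP'm).1.2 (hιmem Q' hQ'm).1.2
    exact ENat.toNat_le_toNat (le_trans le_self_add hle) hfin.ne
  have hιS : ∀ P' ∈ S', ι P' ∈ S := fun P' hP' => hmemS.mpr (hιmem P' (hmemS'.mp hP'))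
  have hinjS : Set.InjOn ι S' := fun P' hP' Q' hQ' h => hinjOn (hmemS'.mp hP') (hmemS'.mp hQ') h
  have hmain := budget_comparison S' S ι hιS hinjS (charge d A' N') (fun _ => 1) (charge d A N)
    (fun P' Q' => (pairVal P' Q').toNat) (fun P Q => (pairVal P Q).toNat) hq hc
  rw [conflictBudgetD_eq_sum hfinS' N', conflictBudgetD_eq_sum hfinS N, ← hSdef, ← hS'def]
  refine ⟨by omega, fun P₀ hP₀ ha₀ => ?_⟩
  -- `P₀` does not survive: a surviving image has `v(u₁) = a′ + b′ ≥ 2`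
  have hsurv : ∀ P' ∈ S', ι P' ≠ P₀ := by
    intro P' hP' h
    obtain ⟨ha', hb', h1a, h1b, -, haa⟩ := hvals P' (hmemS'.mp hP')
    rw [h, ha₀] at haa
    have h2 : (2 : ℕ∞) ≤ branchVal P' (X 0) + branchVal P' (X 1) := by
      calc (2 : ℕ∞) = 1 + 1 := by norm_num
        _ ≤ _ := add_le_add h1a h1b
    rw [haa] at h2
    exact absurd h2 (by norm_num)
  have hP₀S : P₀ ∈ S := hmemS.mpr hP₀
  have hmem : P₀ ∈ S.filter (fun Q => Q ∉ S'.image ι) := mem_filter_not_mem_image.mpr ⟨hP₀S, hsurv⟩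
  have h1 : charge d A N P₀ ≤ ∑ Q ∈ S.filter (fun Q => Q ∉ S'.image ι), charge d A N Q :=
    Finset.single_le_sum (fun _ _ => Nat.zero_le _) hmem
  have h2 : 2 ≤ charge d A N P₀ := two_le_charge p hd2 hsq (topPrimesDNL_subset_topPrimesNL d A hP₀) N
  omega

/-- **B6 STEP `u₂`-ORIGIN: the conf-law** — at a conflict state the budget drops (the conflict branch of D5 dies). -/
theorem conflictBudgetD_blowTwoT_lt_of_dim (p : ℕ) [Fact p.Prime] [CharP k p] [IsAlgClosed k]
    (hΦ : ∀ f, Φ f = subst (![X 0 * X 1, X 1, X 1 * X 2] : Fin 3 → MvPowerSeries (Fin 3) k) f)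
    (hB3 : ∀ (P' : Ideal (MvPowerSeries (Fin 3) k)) [P'.IsPrime], ringKrullDim (MvPowerSeries (Fin 3) k ⧸ P') = 1 →
      (X 1 : MvPowerSeries (Fin 3) k) ∉ P' →
      ringKrullDim (MvPowerSeries (Fin 3) k ⧸ P'.comap Φ) = 1 ∧ ∀ f, branchVal (P'.comap Φ) f = branchVal P' (Φ f))
    (hB4 : ∀ (P' : Ideal (MvPowerSeries (Fin 3) k)), P' ∈ topPrimes d (blowTwoT d A) → (X 1 : MvPowerSeries (Fin 3) k) ∉ P' →
      ringKrullDim (MvPowerSeries (Fin 3) k ⧸ P') = 1 → P'.comap Φ ∈ topPrimes d A)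
    (hD3 : ∀ (P Q : Ideal (MvPowerSeries (Fin 3) k)), P ∈ topPrimes d A → Q ∈ topPrimes d A → P ≠ Q →
      ringKrullDim (MvPowerSeries (Fin 3) k ⧸ P) = 1 → ringKrullDim (MvPowerSeries (Fin 3) k ⧸ Q) = 1 → pairVal P Q < ⊤)
    (hinj : ∀ (P' Q' : Ideal (MvPowerSeries (Fin 3) k)), P'.IsPrime → Q'.IsPrime → ringKrullDim (MvPowerSeries (Fin 3) k ⧸ P') = 1 →
      ringKrullDim (MvPowerSeries (Fin 3) k ⧸ Q') = 1 → (X 1 : MvPowerSeries (Fin 3) k) ∉ P' → (X 1 : MvPowerSeries (Fin 3) k) ∉ Q' →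
      P'.comap Φ = Q'.comap Φ → P' = Q')
    (hctx : ∃ (b : MvPowerSeries (Fin (2 + 1)) k) (δ : TameFourTupleDrop.Decoration k 2) (Θ : Fin (2 + 1) → MvPowerSeries (Fin (2 + 1)) k),
      TameFourTupleDrop.Admissible b δ ∧ 2 ≤ δ.o ∧ δ.c = d ∧ δ.PresBy d A N Θ)
    (hin : InPoly d A) (hconf : NCPoly.Conflict d A N) (hN' : N' = insert 1 (N.filter fun l => l = 0)) :
    conflictBudgetD d (blowTwoT d A) N' < conflictBudgetD d A N := by
  have hd2 : 2 ≤ d := NCBranchPrimes.two_le_of_presContext hctx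
  have hsq : Squarefree (NCPoly.monicGerm d A) := NCBranchPrimes.squarefree_monicGerm_of_presContext hctx
  obtain ⟨P₀, hP₀, ha₀⟩ := exists_transverse_of_conflict p hctx hin hconf
  have hP₀D : P₀ ∈ topPrimesDNL d A := mem_topPrimesDNL_of_mem_topPrimesNL hP₀ (ringKrullDim_eq_one_of_mem_topPrimes p hd2 hsq hP₀.1)
  exact (conflictBudgetD_blowTwoT_le_of_dim Φ p hΦ hB3 hB4 hD3 hinj hctx hN').2 P₀ hP₀D ha₀

end Step

end TOT2Branch

end Summit.ResolutionOfSingularities.ResolutionOfSingularities.Theorems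

end
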